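import Summits.BirchSwinnertonDyer.BirchSwinnertonDyer.Theorems.ByReductionTypeAtTwoGoodOrdTowerControlP
import Summits.BirchSwinnertonDyer.Rank1Residual.GaloisImage.LocalEulerPoincareCharacteristicHolds
import HarnessLib

/-!
# Route `ByReductionTypeAtTwo`, item `OrdKatoHalfAtTwo` (stmt-BirchSwinnertonDyer-19271), TOWER road: MAZUR'S CONTROL
# THEOREM over `ℚ` at EVERY prime `p` for globally minimal `W` — UNCONDITIONAL

HONEST FRAMING (cell `bsd-2adic`, run/shared/lean/pub/bsd-2adic/, seat `bsd-2adic-tower-1` GEN 21, HUMAN RULINGS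
D-0036 / D-0054 / D-0074; planner WAKE-IDLE `plan/WAKE-IDLE-2ADIC-controlP-unconditional.md`, audit-2 GEN 38/39
preflight): theorems only (no definition, no named fact, no `sorry`, axioms the standard trio); closes no route item by
itself; nothing booked; outside the `p = 2` partition proper (the `p = 2` case is `selmer_control_two`,
`…GoodOrdTowerControl.lean`); BSD is not proved by any of this.

WHAT IT PROVES. `…GoodOrdTowerControlP.lean` (GEN 20) proved Mazur's control theorem `W.selmer_control κ` over `ℚ` at every
prime `p` CONDITIONAL on Tate's local Euler–Poincaré characteristic formula `localEulerPoincareCharacteristic ℚ_v` at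
`v ∣ p` (Milne ADT I Thm. 2.8). That named fact is a TREE THEOREM since 2026-08-21 —
`Literature.NumberTheory.GaloisRepresentations.localEulerPoincareCharacteristic_holds` (every non-archimedean local field of
characteristic `0`, every finite discrete module; `Summits/…/Rank1Residual/GaloisImage/LocalEulerPoincareCharacteristicHolds`).
Feeding it discharges the hypothesis:

* `localEP_rat` — Tate's formula for `ℚ_v = v.adicCompletion ℚ` at every place `v` (the `∀`-binder type of ControlP).
* `exists_natCard_localTowerKerPrimary_le` — Greenberg's Lemma 3.4, boundedness clause, at `v ∣ p`, EVERY `p`, no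
  hypothesis beyond good ordinary reduction at `p` and `κ` cyclotomic.
* `Greenberg1999_kerG_bounded_all` — the named predicate `W.Greenberg1999_kerG_bounded κ` (Lemma 3.5) at every `p`.
* `selmer_control_all` — **MAZUR'S CONTROL THEOREM `W.selmer_control κ` over `ℚ` at EVERY prime `p`, every globally
  minimal `W`, every `κ : ZpExtension ℚ p`, with NO hypothesis.**
* `isTorsion_of_finite_selmerGroup_all` — Greenberg's Thm. 1.4 through the control chain at every `p` (for the record;
  the layer-`0` route `SelmerDualData.isTorsion_of_finite_selmerGroup_rat` already gives it).

References: B. Mazur, *Rational points of abelian varieties with values in towers of number fields*, Invent. Math. 18 (1972),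
§6; R. Greenberg, *Iwasawa theory for elliptic curves*, LNM 1716 (1999), Thm. 1.2 (pp. 59–60), Thm. 1.4, §3 Lemmas 3.1–3.5
(pp. 86–90); J. Milne, *Arithmetic Duality Theorems* (2006), I Thm. 2.8.
-/

set_option autoImplicit false
-- the Theorems namespace of this sub repeats the summit name by design (D-0017 nested layout: Summit.<S>.<Sub>)
set_option linter.dupNamespace false

noncomputable section

open scoped Classical

namespace Summit.BirchSwinnertonDyer.BirchSwinnertonDyer.Theorems.GoodOrdTower

open NumberField IsDedekindDomain Literature.NumberTheory.EllipticCurves Literature.NumberTheory.GaloisRepresentations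
  Literature.NumberTheory.EllipticCurves.Rank1Residual WeierstrassCurve

/-- **Tate's local Euler–Poincaré characteristic formula for `ℚ_v`** at every finite place `v` of `ℚ` — the `∀`-binder of
`selmer_control_of_localEP`, discharged by the tree theorem `localEulerPoincareCharacteristic_holds` (the `CharZero ℚ_v`
instance is passed explicitly, from the injectivity of `ℚ → ℚ_v`). [cite: MilneADT2006, I Thm. 2.8 (p. 31)] -/
theorem localEP_rat (p : ℕ) :
    ∀ v : HeightOneSpectrum (𝓞 ℚ), ((p : ℕ) : 𝓞 ℚ) ∈ v.asIdeal →
      localEulerPoincareCharacteristic (v.adicCompletion ℚ) :=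
  fun v _ ↦ @localEulerPoincareCharacteristic_holds (v.adicCompletion ℚ) _ _ _ _
    (charZero_of_injective_algebraMap (algebraMap ℚ (v.adicCompletion ℚ)).injective)

/-- **Greenberg's Lemma 3.4 (boundedness clause) at `v ∣ p`, EVERY prime `p`, unconditionally**: for `W/ℚ` globally minimal
elliptic with good ordinary reduction at `p`, `κ` the cyclotomic `ℤ_p`-extension and `v ∣ p`, the `p`-power torsion of the
local tower kernels `𝒦_{v,n}[p^∞]` is finite of order bounded independently of the layer `n`.
[cite: GreenbergLNM1716, §3 Lemma 3.4 (p. 89)] [cite: MilneADT2006, I Thm. 2.8] -/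
theorem exists_natCard_localTowerKerPrimary_le {p : ℕ} [Fact p.Prime] (W : WeierstrassCurve ℚ)
    [W.IsGloballyMinimal] [W.IsElliptic]
    (hgo : GoodOrd W p) (κ : ZpExtension ℚ p) (hκ : κ.IsCyclotomic) (v : HeightOneSpectrum (𝓞 ℚ))
    (hpv : ((p : ℕ) : 𝓞 ℚ) ∈ v.asIdeal) :
    ∃ C : ℕ, ∀ n : ℕ, Finite (W.localTowerKerPrimary κ (v.adicCompletion ℚ) n) ∧
      Nat.card (W.localTowerKerPrimary κ (v.adicCompletion ℚ) n) ≤ C :=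
  exists_natCard_localTowerKerPrimary_le_of_localEP W hgo κ hκ v hpv (localEP_rat p v hpv)

/-- **Greenberg's Lemma 3.5 at every prime, unconditionally**: for `W/ℚ` globally minimal, `p` prime and
`κ : ZpExtension ℚ p` the named predicate `W.Greenberg1999_kerG_bounded κ` holds (under its hypotheses — `W` elliptic, `κ`
cyclotomic, good ordinary reduction above `p` — the orders of `ker(g_n)` are bounded in `n`).
[cite: GreenbergLNM1716, §3 Lemma 3.5 (p. 90) with Lemma 3.4 (p. 89)] [cite: MilneADT2006, I Thm. 2.8] -/
theorem Greenberg1999_kerG_bounded_all {p : ℕ} [Fact p.Prime] (W : WeierstrassCurve ℚ) [W.IsGloballyMinimal]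
    (κ : ZpExtension ℚ p) : W.Greenberg1999_kerG_bounded κ :=
  Greenberg1999_kerG_bounded_of_localEP W κ (localEP_rat p)

/-- **MAZUR'S CONTROL THEOREM over `ℚ` at EVERY prime `p` — unconditional** (Greenberg, LNM 1716, Thm. 1.2; Mazur 1972,
§6): for every globally minimal `W/ℚ`, every prime `p` and every `κ : ZpExtension ℚ p` the named predicate
`W.selmer_control κ` holds — if `W` is elliptic with good ordinary reduction at `p` and `κ` is the cyclotomic `ℤ_p`-extension,
the natural maps `Sel_{p^∞}(E/ℚ_n) → Sel_{p^∞}(E/ℚ_∞)^{Gal(ℚ_∞/ℚ_n)}` have finite kernels and cokernels of orders bounded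
independently of `n`. Proof: `selmer_control_of_localEP` (GEN 20) with Tate's local Euler–Poincaré formula fed by name
(`localEP_rat`). No named fact, no print binder, no hypothesis beyond `[W.IsGloballyMinimal]`.
[cite: GreenbergLNM1716, Thm 1.2 (pp. 59–60) and §3 (pp. 86–90)] [cite: MazurInvent1972, §6] [cite: MilneADT2006, I Thm. 2.8] -/
theorem selmer_control_all {p : ℕ} [Fact p.Prime] (W : WeierstrassCurve ℚ) [W.IsGloballyMinimal] (κ : ZpExtension ℚ p) :
    W.selmer_control κ :=
  selmer_control_of_localEP W κ (localEP_rat p)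

/-- **Greenberg's Theorem 1.4 at every prime through the control chain** (for the record; the layer-`0` route
`SelmerDualData.isTorsion_of_finite_selmerGroup_rat` gives it too): for `W/ℚ` globally minimal, `κ : ZpExtension ℚ p` with
topological generator `γ` and any dual datum `D` of `Sel_{p^∞}(E/ℚ_∞)`, the named fact `D.isTorsion_of_finite_selmerGroup`
holds — good ordinary reduction at `p` and `Sel_{p^∞}(E/ℚ)` finite imply `X(E/ℚ_∞)` is `Λ`-torsion.
[cite: GreenbergLNM1716, Thm 1.4 (p. 60; proof p. 61)] -/
theorem isTorsion_of_finite_selmerGroup_all {p : ℕ} [Fact p.Prime] (W : WeierstrassCurve ℚ) [W.IsGloballyMinimal]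
    (κ : ZpExtension ℚ p) {γ : Field.absoluteGaloisGroup ℚ} (D : SelmerDualData W κ γ) :
    D.isTorsion_of_finite_selmerGroup :=
  D.isTorsion_of_finite_selmerGroup_of_kerG_bounded (Greenberg1999_kerG_bounded_all W κ)

/-- The closed proposition: Mazur's control theorem over `ℚ` for every prime at once.
[cite: GreenbergLNM1716, Thm 1.2 (pp. 59–60)] -/
theorem selmer_control_forall_prime :
    ∀ (p : ℕ) [Fact p.Prime] (W : WeierstrassCurve ℚ) [W.IsGloballyMinimal] (κ : ZpExtension ℚ p), W.selmer_control κ :=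
  fun _ _ W _ κ ↦ selmer_control_all W κ

end Summit.BirchSwinnertonDyer.BirchSwinnertonDyer.Theorems.GoodOrdTower

end
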